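import Literature.Analysis.FluidPDE.OnsagerProofs
import Literature.Analysis.FluidPDE.EulerReynoldsMollification
import Literature.Analysis.FunctionSpaces.TorusSpaceTimeConvolution
import Literature.Analysis.FunctionSpaces.TorusEnstrophyOrthogonality
import HarnessLib

/-!
# The space–time mollification of a weak Euler solution solves Euler–Reynolds up to a gradient

Analysis/FluidPDE support file (serves the discharge of
`Literature.Barriers.AnomalousDissipation.BuckmasterVicol2019_mollifiedEulerStart`, the start of
the Buckmaster–Vicol vanishing-viscosity scheme, Ann. of Math. 189 (2019), §2.5: "let `φ_ε`,
`ϕ_ε` be standard Friedrichs mollifiers on `T³` and on `ℝ` … `v_n = (u ∗ₓ φ) ∗ₜ ϕ`. Since `u` is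
a solution of the Euler equations, there exists a mean-free `p_n` such that
`∂ₜ v_n + div (v_n ⊗ v_n) + ∇p_n - λ_n^{-2} Δ v_n = div R̊_n`, where `R̊_n` is the traceless
symmetric part of the tensor `(v_n ⊗ v_n) - ((u ⊗ u) ∗ₓ φ) ∗ₜ ϕ - λ_n^{-2} ∇v_n`").

The analytic content of "since `u` is a solution of the Euler equations, there exists `p_n`" is
proved here: for a bounded, strongly measurable velocity field `U` on `ℝ × T^d` vanishing off the
time slab `[0, T₀]` which is a weak (distributional, pressure-free) Euler solution on
`T^d × (0, T₀)` (`Torus.IsWeakEulerSolutionOn`), the space–time mollification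
`V = Torus.mollifiedField φ ε U` (time kernel `ρ = φ.normed`, space kernel `k_ε`) and the
mollified momentum flux `𝒯`, `𝒯ᵢⱼ = ρ ⋆ₜ (UᵢUⱼ) ⋆ₓ k_ε` (`Torus.mollifiedFlux`), satisfy at
every time `t` whose `ρ`-window `[t - rOut, t + rOut]` lies inside `(0, T₀)`:

  `∫_{T^d} ⟪∂ₜV(t) + div 𝒯(t), w⟫ = 0` for every smooth divergence-free `w`

(`Torus.integral_inner_mollifiedEulerResidual_eq_zero`), i.e. the residual
`Torus.mollifiedEulerResidual φ ε U t = ∂ₜV(t) + div 𝒯(t)` is `L²`-orthogonal to smooth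
solenoidal fields; by `TorusPressureReconstruction` it is then a smooth gradient `∇q(t)`.

## The argument (Constantin–E–Titi 1994, p. 209, "proceed as if the solution is differentiable
in time"; De Lellis–Székelyhidi 2009, §1)

Fix `t` and a smooth divergence-free `w`; put `W = w ⋆ₓ k_ε` (smooth, divergence free) and
`a(s) = ∫ ⟪U(s), W⟫`, `b(s) = ∫ ⟪U(s), (U(s)·∇)W⟫`.
1. *Weak formulation with a product test field.* `ψ(s, y) = ρ(t - s) W(y)` is an admissible
   divergence-free test field supported in `(0, T₀)`; since `∂ₛψ = -ρ'(t - s) W` and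
   `(U·∇)ψ = ρ(t - s) (U·∇)W`, the weak Euler identity reads `∫ ρ'(t - s) a(s) ds = ∫ ρ(t - s) b(s) ds`
   (`Torus.weakEuler_product_test`).
2. *The time derivative.* `∂ₜVᵢ(t, x) = ∫ ρ'(t - s) (Uᵢ(s) ⋆ k_ε)(x) ds`
   (`timeDeriv_mollifiedField_apply`), so by Fubini and the symmetry of mollification by the even
   kernel `k_ε` (`Torus.integral_mul_convolution_comm`), `∫ ⟪∂ₜV(t), w⟫ = ∫ ρ'(t - s) a(s) ds`.
3. *The flux.* `∫ ⟪div 𝒯(t), w⟫ = -∑ᵢⱼ ∫ 𝒯ᵢⱼ ∂ⱼwᵢ` (no boundary), and the same two moves give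
   `-∫ ρ(t - s) ∑ᵢⱼ ∫ UᵢUⱼ (∂ⱼwᵢ ⋆ k_ε) ds = -∫ ρ(t - s) b(s) ds` (`∂ⱼ(wᵢ ⋆ k_ε) = (∂ⱼwᵢ) ⋆ k_ε`).
Adding 2 and 3 and using 1 gives zero.

## Mathlib / tree search

Everything about `mollifiedField` (joint smoothness, `∂ₜ`, coordinates as time averages of spatial
mollifications) is the accepted `FluidPDE/OnsagerProofs` (Part 1) and `TorusTimeAverage`;
adjointness of spatial mollification `Torus.integral_mul_convolution_comm` and
`Torus.convolution_partialDeriv_right`, `Torus.IsDivFree.vecConv` are `TorusSpaceTimeConvolution`;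
`Torus.tensorDivergence`, `Torus.integral_inner_tensorDivergence` are `FluidPDE/EulerReynolds`,
`Torus.isSmooth_tensor` is `EulerReynoldsMollification`. Nothing is restated; no named facts are
introduced. Mathlib: Fubini (`integral_integral_swap`), `setIntegral_eq_integral_of_forall_compl_eq_zero`.

## References

* T. Buckmaster, V. Vicol, Ann. of Math. 189 (2019), §2.5. [`BuckmasterVicol2019Annals`]
* P. Constantin, W. E, E. S. Titi, Comm. Math. Phys. 165 (1994), p. 209.
* C. De Lellis, L. Székelyhidi Jr., Arch. Ration. Mech. Anal. 195 (2010), §1 (weak solutions).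
-/

noncomputable section

open MeasureTheory TopologicalSpace Set Function Filter Metric ContinuousLinearMap
open _root_.Topology
open scoped ENNReal NNReal Convolution InnerProductSpace ContDiff

namespace Literature.Analysis.FluidPDE

namespace Torus

open FunctionSpaces.Torus (stLift lift kernel IsSmooth IsContDiff IsDivFree mollifiedField vecMollify)
open FunctionSpaces (timeAvgWith)

variable {d : Type*} [Fintype d] [DecidableEq d]

/-! ## The data: a bounded measurable field on a time slab -/

section Data

variable {U : ℝ → UnitAddTorus d → EuclideanSpace ℝ d} {M T₀ : ℝ}

omit [Fintype d] [DecidableEq d] in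
/-- A bounded strongly measurable space–time field vanishing off a compact time slab is
integrable on `ℝ × T^d`. [folklore] -/
theorem integrable_uncurry_of_bounded [Fintype d] {X : Type*} [NormedAddCommGroup X]
    {F : ℝ → UnitAddTorus d → X} (hFm : StronglyMeasurable (uncurry F)) {C : ℝ}
    (hC : ∀ s y, ‖F s y‖ ≤ C) {a b : ℝ} (h0 : ∀ s, s ∉ Icc a b → F s = 0) :
    Integrable (uncurry F) ((volume : Measure ℝ).prod (volume : Measure (UnitAddTorus d))) := by
  have hdom : Integrable (fun p : ℝ × UnitAddTorus d => (Icc a b).indicator (fun _ => C) p.1)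
      ((volume : Measure ℝ).prod (volume : Measure (UnitAddTorus d))) :=
    ((integrable_indicator_iff measurableSet_Icc).2
      (integrableOn_const (by rw [Real.volume_Icc]; exact ENNReal.ofReal_ne_top))).comp_fst volume
  refine hdom.mono' hFm.aestronglyMeasurable (Eventually.of_forall fun p => ?_)
  by_cases hp : p.1 ∈ Icc a b
  · simp only [indicator_of_mem hp, uncurry]
    exact hC p.1 p.2
  · simp only [indicator_of_notMem hp, uncurry]
    rw [h0 p.1 hp, Pi.zero_apply, norm_zero]

omit [Fintype d] [DecidableEq d] in
/-- Slices of a strongly measurable space–time field are strongly measurable. [folklore] -/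
theorem stronglyMeasurable_slice [Fintype d] {X : Type*} [TopologicalSpace X]
    {F : ℝ → UnitAddTorus d → X} (hFm : StronglyMeasurable (uncurry F)) (s : ℝ) :
    StronglyMeasurable (F s) :=
  hFm.comp_measurable (measurable_const.prodMk measurable_id)

omit [DecidableEq d] in
/-- The products `UⱼU` (columns of `U ⊗ U`) inherit measurability. [folklore] -/
theorem stronglyMeasurable_uncurry_smul_apply (hUm : StronglyMeasurable (uncurry U)) (j : d) :
    StronglyMeasurable (uncurry fun s y => U s y j • U s y) :=
  (((EuclideanSpace.proj j : EuclideanSpace ℝ d →L[ℝ] ℝ).continuous.comp_stronglyMeasurable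
    hUm).smul hUm)

omit [DecidableEq d] in
/-- The products `UⱼU` are bounded by `M²`. [folklore] -/
theorem norm_smul_apply_le (hUb : ∀ s y, ‖U s y‖ ≤ M) (j : d) (s : ℝ) (y : UnitAddTorus d) :
    ‖U s y j • U s y‖ ≤ M ^ 2 := by
  have hM : 0 ≤ M := (norm_nonneg _).trans (hUb s y)
  rw [norm_smul, pow_two]
  exact mul_le_mul ((PiLp.norm_apply_le (U s y) j).trans (hUb s y)) (hUb s y) (norm_nonneg _) hM

omit [Fintype d] [DecidableEq d] in
/-- The products `UⱼU` vanish where `U` does. [folklore] -/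
theorem smul_apply_eq_zero_off [Fintype d] (hU0 : ∀ s, s ∉ Icc 0 T₀ → U s = 0) (j : d) (s : ℝ)
    (hs : s ∉ Icc 0 T₀) : (fun y => U s y j • U s y) = 0 := by
  funext y
  simp [hU0 s hs]

end Data

/-! ## The mollified flux and the residual -/

section Defs

omit [DecidableEq d] in
/-- **The mollified momentum flux** `𝒯 = ((u ⊗ u) ∗ₓ φ) ∗ₜ ϕ` of Buckmaster–Vicol 2019, §2.5,
stored by columns: column `j` is the space–time mollification (`Torus.mollifiedField`) of the
vector field `Uⱼ U`, so that `𝒯(t, x)ⱼᵢ = (ρ ⋆ₜ (UᵢUⱼ) ⋆ₓ k_ε)(t, x)`.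
[cite: BuckmasterVicol2019Annals, §2.5] -/
def mollifiedFlux (φ : ContDiffBump (0 : ℝ)) (ε : ℝ) (U : ℝ → UnitAddTorus d → EuclideanSpace ℝ d)
    (t : ℝ) (x : UnitAddTorus d) : d → EuclideanSpace ℝ d :=
  fun j => mollifiedField φ ε (fun s y => U s y j • U s y) t x

/-- **The residual of the mollified Euler equation**, `∂ₜV + div 𝒯` with
`V = Torus.mollifiedField φ ε U` and `𝒯 = Torus.mollifiedFlux φ ε U` (the quantity that
Buckmaster–Vicol 2019, §2.5 write as `-∇p_n`). [cite: BuckmasterVicol2019Annals, §2.5] -/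
def mollifiedEulerResidual (φ : ContDiffBump (0 : ℝ)) (ε : ℝ)
    (U : ℝ → UnitAddTorus d → EuclideanSpace ℝ d) (t : ℝ) (x : UnitAddTorus d) : EuclideanSpace ℝ d :=
  FunctionSpaces.Torus.timeDeriv (mollifiedField φ ε U) t x + tensorDivergence (mollifiedFlux φ ε U t) x

omit [DecidableEq d] in
/-- Unfolding the columns of the mollified flux. [folklore] -/
theorem mollifiedFlux_apply (φ : ContDiffBump (0 : ℝ)) (ε : ℝ)
    (U : ℝ → UnitAddTorus d → EuclideanSpace ℝ d) (t : ℝ) (x : UnitAddTorus d) (j : d) :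
    mollifiedFlux φ ε U t x j = mollifiedField φ ε (fun s y => U s y j • U s y) t x := rfl

/-- Unfolding the residual. [folklore] -/
theorem mollifiedEulerResidual_apply (φ : ContDiffBump (0 : ℝ)) (ε : ℝ)
    (U : ℝ → UnitAddTorus d → EuclideanSpace ℝ d) (t : ℝ) (x : UnitAddTorus d) :
    mollifiedEulerResidual φ ε U t x =
      FunctionSpaces.Torus.timeDeriv (mollifiedField φ ε U) t x + tensorDivergence (mollifiedFlux φ ε U t) x := rfl

end Defs

/-! ## Step 1: the weak formulation tested with a product field -/

section ProductTest

variable {U : ℝ → UnitAddTorus d → EuclideanSpace ℝ d} {φ : ContDiffBump (0 : ℝ)} {M T₀ : ℝ}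

omit [Fintype d] [DecidableEq d] in
/-- The time kernel `ρ(t - ·)` and its derivative vanish at every `s ∉ (0, T₀)` once the window
`[t - rOut, t + rOut]` lies inside `(0, T₀)`. [folklore] -/
theorem normed_sub_eq_zero_of_not_mem (φ : ContDiffBump (0 : ℝ)) {t : ℝ} (ht1 : φ.rOut < t)
    (ht2 : t + φ.rOut < T₀) {s : ℝ} (hs : s ∉ Ioo 0 T₀) :
    φ.normed volume (t - s) = 0 ∧ deriv (φ.normed volume) (t - s) = 0 := by
  have hr := φ.rOut_pos
  have hfar : φ.rOut < |t - s| := by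
    simp only [mem_Ioo, not_and_or, not_lt] at hs
    rcases hs with hs | hs
    · rw [abs_of_pos (by linarith)]; linarith
    · rw [abs_of_neg (by linarith)]; linarith
  have hopen : IsOpen {x : ℝ | φ.rOut < |x|} := isOpen_lt continuous_const continuous_abs
  have hev : (φ.normed volume : ℝ → ℝ) =ᶠ[𝓝 (t - s)] fun _ => 0 := by
    filter_upwards [hopen.mem_nhds hfar] with x hx
    exact FunctionSpaces.normed_eq_zero_of_rOut_le_abs φ (le_of_lt hx)
  refine ⟨FunctionSpaces.normed_eq_zero_of_rOut_le_abs φ hfar.le, ?_⟩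
  rw [hev.deriv_eq, deriv_const]

omit [DecidableEq d] in
/-- The product test field `ψ(s, y) = ρ(t - s) • W(y)` is a space–time test field supported in
`(0, T₀)` when `W` is smooth and the `ρ`-window of `t` lies in `(0, T₀)`. [folklore] -/
theorem isSpaceTimeTestIoo_product (φ : ContDiffBump (0 : ℝ)) {t : ℝ} (ht1 : φ.rOut < t)
    (ht2 : t + φ.rOut < T₀) {W : UnitAddTorus d → EuclideanSpace ℝ d} (hW : IsSmooth W) :
    FunctionSpaces.Torus.IsSpaceTimeTestIoo T₀ (fun s y => φ.normed volume (t - s) • W y) := by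
  have hr := φ.rOut_pos
  refine ⟨⟨?_, t + φ.rOut, ht2, fun s hs => ?_⟩, t - φ.rOut, by linarith, fun s hs => ?_⟩
  · have hρ : ContDiff ℝ ∞ (φ.normed volume) := φ.contDiff_normed
    change ContDiff ℝ ∞ fun p : ℝ × EuclideanSpace ℝ d => φ.normed volume (t - p.1) • W (FunctionSpaces.Torus.proj p.2)
    exact (hρ.comp (contDiff_const.sub contDiff_fst)).smul (hW.comp contDiff_snd)
  · funext y
    have : φ.normed volume (t - s) = 0 :=
      FunctionSpaces.normed_eq_zero_of_rOut_le_abs φ (by rw [abs_of_nonpos (by linarith)]; linarith)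
    simp [this]
  · funext y
    have : φ.normed volume (t - s) = 0 :=
      FunctionSpaces.normed_eq_zero_of_rOut_le_abs φ (by rw [abs_of_nonneg (by linarith)]; linarith)
    simp [this]

/-- The product test field is divergence free when `W` is. [folklore] -/
theorem isDivFreeTest_product (φ : ContDiffBump (0 : ℝ)) (t : ℝ)
    {W : UnitAddTorus d → EuclideanSpace ℝ d} (hW : IsSmooth W) (hdiv : IsDivFree W) :
    FunctionSpaces.Torus.IsDivFreeTest (fun s y => φ.normed volume (t - s) • W y) :=
  fun _ => hdiv.const_smul hW _

omit [Fintype d] [DecidableEq d] in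
/-- The time derivative of the product test field: `∂ₛ(ρ(t - s) W(y)) = -ρ'(t - s) W(y)`. [folklore] -/
theorem timeDeriv_product [Fintype d] (φ : ContDiffBump (0 : ℝ)) (t : ℝ) (W : UnitAddTorus d → EuclideanSpace ℝ d)
    (s : ℝ) (y : UnitAddTorus d) :
    FunctionSpaces.Torus.timeDeriv (fun s y => φ.normed volume (t - s) • W y) s y =
      (-deriv (φ.normed volume) (t - s)) • W y := by
  have hρd : Differentiable ℝ (φ.normed volume) :=
    (φ.contDiff_normed (n := 1)).differentiable one_ne_zero
  have h1 : HasDerivAt (fun τ : ℝ => φ.normed volume (t - τ)) (-deriv (φ.normed volume) (t - s)) s :=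
    HasDerivAt.comp_const_sub t s (hρd (t - s)).hasDerivAt
  exact (h1.smul_const (W y)).deriv

omit [DecidableEq d] in
/-- The convective term of the product test field: `(U·∇)(ρ W) = ρ (U·∇)W`. [folklore] -/
theorem convect_product (φ : ContDiffBump (0 : ℝ)) (t : ℝ) {W : UnitAddTorus d → EuclideanSpace ℝ d}
    (hW : IsSmooth W) (u : UnitAddTorus d → EuclideanSpace ℝ d) (s : ℝ) (y : UnitAddTorus d) :
    FunctionSpaces.Torus.convect u (fun y => φ.normed volume (t - s) • W y) y =
      φ.normed volume (t - s) • FunctionSpaces.Torus.convect u W y := by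
  simp only [FunctionSpaces.Torus.convect]
  rw [show (fun y => φ.normed volume (t - s) • W y) = φ.normed volume (t - s) • W from rfl,
    FunctionSpaces.Torus.fderiv_const_smul (hW.isContDiff (by simp))]
  rfl

omit [DecidableEq d] in
/-- Slices of `U` are integrable on the torus. [folklore] -/
theorem integrable_slice (hUm : StronglyMeasurable (uncurry U)) (hUb : ∀ s y, ‖U s y‖ ≤ M) (s : ℝ) :
    Integrable (U s) volume :=
  (integrable_const M).mono' (stronglyMeasurable_slice hUm s).aestronglyMeasurable
    (Eventually.of_forall fun y => hUb s y)

omit [DecidableEq d] in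
/-- The pairing `a(s) = ∫ ⟪U(s), W⟫` is bounded: `|a(s)| ≤ M sup ‖W‖`. [folklore] -/
theorem norm_integral_inner_le (hUb : ∀ s y, ‖U s y‖ ≤ M)
    {W : UnitAddTorus d → EuclideanSpace ℝ d} {CW : ℝ} (hCW : ∀ y, ‖W y‖ ≤ CW) (s : ℝ) :
    ‖∫ y, ⟪U s y, W y⟫_ℝ‖ ≤ M * CW := by
  have hM : 0 ≤ M := (norm_nonneg _).trans (hUb s 0)
  refine (norm_integral_le_of_norm_le (integrable_const (M * CW))
    (Eventually.of_forall fun y => ?_)).trans (by simp)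
  exact (norm_inner_le_norm _ _).trans (mul_le_mul (hUb s y) (hCW y) (norm_nonneg _) hM)

/-- **Step 1: the weak Euler identity tested with the product field `ρ(t - ·) ⊗ W`.** For a
bounded measurable weak Euler solution `U` on `(0, T₀)` vanishing off `[0, T₀]`, a smooth
divergence-free `W`, and `t` with `[t - rOut, t + rOut] ⊆ (0, T₀)`:
`∫ ρ'(t - s) (∫ ⟪U(s), W⟫) ds = ∫ ρ(t - s) (∫ ⟪U(s), (U(s)·∇)W⟫) ds` (De Lellis–Székelyhidi
weak formulation with `ψ = ρ(t - ·) W`, whose `∂ₛψ = -ρ' W`, `(U·∇)ψ = ρ (U·∇)W`). [folklore] -/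
theorem weakEuler_product_test (hUm : StronglyMeasurable (uncurry U)) (hUb : ∀ s y, ‖U s y‖ ≤ M)
    (hweak : FunctionSpaces.Torus.IsWeakEulerSolutionOn T₀ U) {t : ℝ} (ht1 : φ.rOut < t)
    (ht2 : t + φ.rOut < T₀) {W : UnitAddTorus d → EuclideanSpace ℝ d} (hW : IsSmooth W)
    (hdiv : IsDivFree W) :
    ∫ s, deriv (φ.normed volume) (t - s) * ∫ y, ⟪U s y, W y⟫_ℝ =
      ∫ s, φ.normed volume (t - s) * ∫ y, ⟪U s y, FunctionSpaces.Torus.convect (U s) W y⟫_ℝ := by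
  set ρ : ℝ → ℝ := φ.normed volume with hρ
  have hM : 0 ≤ M := (norm_nonneg _).trans (hUb 0 0)
  -- bounds on `W` and `DW`
  obtain ⟨CW, hCW⟩ := FunctionSpaces.Torus.exists_forall_norm_le_of_continuous hW.continuous
  obtain ⟨CD, hCD⟩ := FunctionSpaces.Torus.exists_forall_norm_le_of_continuous
    (hW.isContDiff (n := 1) (by simp)).continuous_fderiv
  -- the weak identity with the product test field, integrand in product form
  have hraw := hweak.2.2.2 _ (isSpaceTimeTestIoo_product φ ht1 ht2 hW) (isDivFreeTest_product φ t hW hdiv)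
  have hid : ∫ s in Ioo 0 T₀, ∫ y, ((-deriv ρ (t - s)) * ⟪U s y, W y⟫_ℝ +
      ρ (t - s) * ⟪U s y, FunctionSpaces.Torus.convect (U s) W y⟫_ℝ) = 0 := by
    refine Eq.trans (setIntegral_congr_fun measurableSet_Ioo fun s _ =>
      integral_congr_ae (Eventually.of_forall fun y => ?_)) hraw
    change _ = ⟪U s y, FunctionSpaces.Torus.timeDeriv (fun s y => ρ (t - s) • W y) s y⟫_ℝ +
      ⟪U s y, FunctionSpaces.Torus.convect (U s) (fun y => ρ (t - s) • W y) y⟫_ℝ +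
      0 * ⟪U s y, FunctionSpaces.Torus.laplacian (fun y => ρ (t - s) • W y) y⟫_ℝ
    rw [timeDeriv_product, convect_product φ t hW, real_inner_smul_right, real_inner_smul_right,
      zero_mul, add_zero]
  -- measurability and integrability of the two pairings
  have hUs : ∀ s, AEStronglyMeasurable (U s) volume := fun s =>
    (stronglyMeasurable_slice hUm s).aestronglyMeasurable
  have happly : Continuous fun q : (EuclideanSpace ℝ d →L[ℝ] EuclideanSpace ℝ d) × EuclideanSpace ℝ d =>
      q.1 q.2 := isBoundedBilinearMap_apply.continuous
  have hDWc : Continuous (FunctionSpaces.Torus.fderiv W) :=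
    (hW.isContDiff (n := 1) (by simp)).continuous_fderiv
  have hconv_bd : ∀ s y, ‖FunctionSpaces.Torus.convect (U s) W y‖ ≤ CD * M := fun s y => by
    simp only [FunctionSpaces.Torus.convect]
    exact (le_opNorm _ _).trans (mul_le_mul (hCD y) (hUb s y) (norm_nonneg _)
      ((norm_nonneg _).trans (hCD y)))
  -- joint measurability on `ℝ × T^d`
  have hjm1 : StronglyMeasurable (uncurry fun s y => ⟪U s y, W y⟫_ℝ) :=
    hUm.inner (hW.continuous.comp continuous_snd).stronglyMeasurable
  have hjm2 : StronglyMeasurable (uncurry fun s y => ⟪U s y, FunctionSpaces.Torus.convect (U s) W y⟫_ℝ) := by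
    have h1 : StronglyMeasurable fun p : ℝ × UnitAddTorus d =>
        (FunctionSpaces.Torus.fderiv W p.2, uncurry U p) :=
      (hDWc.comp continuous_snd).stronglyMeasurable.prodMk hUm
    exact hUm.inner (happly.comp_stronglyMeasurable h1)
  have hi1 : ∀ s, Integrable (fun y => ⟪U s y, W y⟫_ℝ) volume := fun s =>
    (integrable_const (M * CW)).mono' (hjm1.comp_measurable
      (measurable_const.prodMk measurable_id)).aestronglyMeasurable
      (Eventually.of_forall fun y => (norm_inner_le_norm _ _).trans
        (mul_le_mul (hUb s y) (hCW y) (norm_nonneg _) hM))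
  have hi2 : ∀ s, Integrable (fun y => ⟪U s y, FunctionSpaces.Torus.convect (U s) W y⟫_ℝ) volume := fun s =>
    (integrable_const (M * (CD * M))).mono' (hjm2.comp_measurable
      (measurable_const.prodMk measurable_id)).aestronglyMeasurable
      (Eventually.of_forall fun y => (norm_inner_le_norm _ _).trans
        (mul_le_mul (hUb s y) (hconv_bd s y) (norm_nonneg _) hM))
  -- the slice integrals
  set a : ℝ → ℝ := fun s => ∫ y, ⟪U s y, W y⟫_ℝ with ha
  set b : ℝ → ℝ := fun s => ∫ y, ⟪U s y, FunctionSpaces.Torus.convect (U s) W y⟫_ℝ with hb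
  have hslice : ∀ s, ∫ y, ((-deriv ρ (t - s)) * ⟪U s y, W y⟫_ℝ +
      ρ (t - s) * ⟪U s y, FunctionSpaces.Torus.convect (U s) W y⟫_ℝ) =
      -(deriv ρ (t - s) * a s) + ρ (t - s) * b s := by
    intro s
    rw [integral_add ((hi1 s).const_mul _) ((hi2 s).const_mul _), integral_const_mul,
      integral_const_mul]
    ring
  simp_rw [hslice] at hid
  -- from `(0, T₀)` to the whole line
  rw [setIntegral_eq_integral_of_forall_compl_eq_zero (fun s hs => by
    obtain ⟨h0, h0'⟩ := normed_sub_eq_zero_of_not_mem φ ht1 ht2 hs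
    change ρ (t - s) = 0 at h0
    change deriv ρ (t - s) = 0 at h0'
    rw [h0, h0']
    ring)] at hid
  -- integrability in time of the two terms
  have ham : AEStronglyMeasurable a volume := (hjm1.integral_prod_right').aestronglyMeasurable
  have hbm : AEStronglyMeasurable b volume := (hjm2.integral_prod_right').aestronglyMeasurable
  have habd : ∀ s, ‖a s‖ ≤ M * CW := fun s => norm_integral_inner_le hUb hCW s
  have hbbd : ∀ s, ‖b s‖ ≤ M * (CD * M) := fun s => by
    refine (norm_integral_le_of_norm_le (integrable_const (M * (CD * M)))
      (Eventually.of_forall fun y => ?_)).trans (by simp)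
    exact (norm_inner_le_norm _ _).trans (mul_le_mul (hUb s y) (hconv_bd s y) (norm_nonneg _) hM)
  have hρi : Integrable (fun s => ρ (t - s)) volume := φ.integrable_normed.comp_sub_left t
  have hρ'i : Integrable (fun s => deriv ρ (t - s)) volume := by
    have h : Integrable (deriv ρ) volume :=
      ((φ.contDiff_normed (μ := volume) (n := 1)).continuous_deriv le_rfl).integrable_of_hasCompactSupport
        φ.hasCompactSupport_normed.deriv
    exact h.comp_sub_left t
  have hI1 : Integrable (fun s => deriv ρ (t - s) * a s) volume :=
    hρ'i.mul_bdd ham (Eventually.of_forall habd)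
  have hI2 : Integrable (fun s => ρ (t - s) * b s) volume :=
    hρi.mul_bdd hbm (Eventually.of_forall hbbd)
  rw [integral_add hI1.fun_neg hI2, integral_neg] at hid
  linarith

end ProductTest

/-! ## Fubini against a time kernel, and adjointness of spatial mollification -/

section Fubini

variable {U : ℝ → UnitAddTorus d → EuclideanSpace ℝ d} {M T₀ : ℝ}

omit [DecidableEq d] in
/-- **Fubini against a time kernel.** For a bounded strongly measurable scalar field `Θ` on
`ℝ × T^d`, an integrable time kernel `r` and a continuous `g` on the torus,
`∫ₓ (∫ₛ r(t - s) Θ(s, x)) g(x) = ∫ₛ r(t - s) ∫ₓ Θ(s, x) g(x)`. [folklore] -/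
theorem integral_integral_kernel_mul_comm {Θ : ℝ → UnitAddTorus d → ℝ}
    (hΘm : StronglyMeasurable (uncurry Θ)) {C : ℝ} (hC : ∀ s x, ‖Θ s x‖ ≤ C) {r : ℝ → ℝ}
    (hr : Integrable r volume) {g : UnitAddTorus d → ℝ} (hg : Continuous g) (t : ℝ) :
    ∫ x, (∫ s, r (t - s) * Θ s x) * g x = ∫ s, r (t - s) * ∫ x, Θ s x * g x := by
  obtain ⟨Cg, hCg⟩ := FunctionSpaces.Torus.exists_forall_norm_le_of_continuous hg
  have hC0 : 0 ≤ C := (norm_nonneg _).trans (hC t 0)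
  -- the integrand on `ℝ × T^d`
  set Φ : ℝ × UnitAddTorus d → ℝ := fun p => r (t - p.1) * Θ p.1 p.2 * g p.2 with hΦ
  have hrt : Integrable (fun s => r (t - s)) volume := hr.comp_sub_left t
  have hΦm : AEStronglyMeasurable Φ ((volume : Measure ℝ).prod volume) := by
    have h1 : AEStronglyMeasurable (fun p : ℝ × UnitAddTorus d => r (t - p.1))
        ((volume : Measure ℝ).prod volume) := hrt.1.comp_fst
    exact (h1.mul hΘm.aestronglyMeasurable).mul (hg.comp continuous_snd).aestronglyMeasurable
  have hΦi : Integrable Φ ((volume : Measure ℝ).prod volume) := by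
    have hdom : Integrable (fun p : ℝ × UnitAddTorus d => ‖r (t - p.1)‖ * (C * Cg))
        ((volume : Measure ℝ).prod volume) := (hrt.norm.mul_const _).comp_fst volume
    refine hdom.mono' hΦm (Eventually.of_forall fun p => ?_)
    simp only [hΦ, norm_mul]
    rw [mul_assoc]
    exact mul_le_mul_of_nonneg_left (mul_le_mul (hC _ _) (hCg _) (norm_nonneg _) hC0) (norm_nonneg _)
  calc ∫ x, (∫ s, r (t - s) * Θ s x) * g x = ∫ x, ∫ s, Φ (s, x) := by
        refine integral_congr_ae (Eventually.of_forall fun x => ?_)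
        show (∫ s, r (t - s) * Θ s x) * g x = ∫ s, Φ (s, x)
        rw [← integral_mul_const]
    _ = ∫ s, ∫ x, Φ (s, x) := (integral_integral_swap hΦi.swap)
    _ = ∫ s, r (t - s) * ∫ x, Θ s x * g x := by
        refine integral_congr_ae (Eventually.of_forall fun s => ?_)
        show ∫ x, Φ (s, x) = r (t - s) * ∫ x, Θ s x * g x
        rw [← integral_const_mul]
        refine integral_congr_ae (Eventually.of_forall fun x => ?_)
        simp only [hΦ]
        ring

omit [DecidableEq d] in
/-- The slice pairings `s ↦ ∫ₓ Θ(s, x) g(x)` of a bounded measurable field with a continuous `g`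
are strongly measurable and bounded. [folklore] -/
theorem stronglyMeasurable_integral_mul {Θ : ℝ → UnitAddTorus d → ℝ}
    (hΘm : StronglyMeasurable (uncurry Θ)) {C : ℝ} (hC : ∀ s x, ‖Θ s x‖ ≤ C)
    {g : UnitAddTorus d → ℝ} (hg : Continuous g) {Cg : ℝ} (hCg : ∀ x, ‖g x‖ ≤ Cg) :
    StronglyMeasurable (fun s => ∫ x, Θ s x * g x) ∧ ∀ s, ‖∫ x, Θ s x * g x‖ ≤ C * Cg := by
  have hC0 : 0 ≤ C := (norm_nonneg _).trans (hC 0 0)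
  refine ⟨(hΘm.mul (hg.comp continuous_snd).stronglyMeasurable).integral_prod_right', fun s => ?_⟩
  refine (norm_integral_le_of_norm_le (integrable_const (C * Cg))
    (Eventually.of_forall fun x => ?_)).trans (by simp)
  rw [norm_mul]
  exact mul_le_mul (hC s x) (hCg x) (norm_nonneg _) hC0

variable {φ : ContDiffBump (0 : ℝ)} {ε : ℝ}

omit [DecidableEq d] in
/-- The spatially mollified slices `(s, x) ↦ (Uᵢ(s) ⋆ k_ε)(x)` of a bounded measurable field are
strongly measurable and bounded by `M ∫ |k_ε| = M`. [folklore] -/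
theorem stronglyMeasurable_convolution_slice {Θ : ℝ → UnitAddTorus d → ℝ}
    (hΘm : StronglyMeasurable (uncurry Θ)) {C : ℝ} (hC : ∀ s x, ‖Θ s x‖ ≤ C)
    (hε : 0 < ε) (hε' : ε ≤ 1 / 4) :
    StronglyMeasurable (uncurry fun s x => (Θ s ⋆ kernel ε) x) ∧
      ∀ s x, ‖(Θ s ⋆ kernel (d := d) ε) x‖ ≤ C := by
  refine ⟨stronglyMeasurable_uncurry_convolution hΘm (FunctionSpaces.Torus.continuous_kernel hε hε'),
    fun s x => ?_⟩
  have h := norm_convolution_le_of_bound (hC s) (FunctionSpaces.Torus.continuous_kernel (d := d) hε hε') x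
  have h1 : ∫ y, ‖kernel (d := d) ε y‖ = 1 :=
    (integral_congr_ae (Eventually.of_forall fun y => by
      simp [Real.norm_eq_abs, abs_of_nonneg (FunctionSpaces.Torus.kernel_nonneg hε.le y)])).trans
      (FunctionSpaces.Torus.integral_kernel (d := d) hε hε')
  rwa [h1, mul_one] at h

end Fubini

/-! ## Step 2: the time derivative of the mollified field against a smooth field -/

section TimeDeriv

variable {U : ℝ → UnitAddTorus d → EuclideanSpace ℝ d} {φ : ContDiffBump (0 : ℝ)} {ε M T₀ : ℝ}

omit [DecidableEq d] in
/-- The derivative of the normalised bump is integrable. [folklore] -/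
theorem integrable_deriv_normed (φ : ContDiffBump (0 : ℝ)) : Integrable (deriv (φ.normed volume)) volume :=
  ((φ.contDiff_normed (μ := volume) (n := 1)).continuous_deriv le_rfl).integrable_of_hasCompactSupport
    φ.hasCompactSupport_normed.deriv

omit [DecidableEq d] in
/-- **Step 2, one coordinate.** `∫ ∂ₜVᵢ(t) g = ∫ ρ'(t - s) (∫ Uᵢ(s) (g ⋆ k_ε)) ds` for a continuous
scalar `g` (`∂ₜVᵢ = ∫ ρ'(t - s) (Uᵢ(s) ⋆ k_ε) ds`, Fubini, symmetry of the even kernel). [folklore] -/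
theorem integral_timeDeriv_mollifiedField_apply_mul (hUm : StronglyMeasurable (uncurry U))
    (hUb : ∀ s y, ‖U s y‖ ≤ M) (hU0 : ∀ s, s ∉ Icc 0 T₀ → U s = 0) (hε : 0 < ε) (hε' : ε ≤ 1 / 4)
    (i : d) {g : UnitAddTorus d → ℝ} (hg : Continuous g) (t : ℝ) :
    ∫ x, FunctionSpaces.Torus.timeDeriv (mollifiedField φ ε U) t x i * g x =
      ∫ s, deriv (φ.normed volume) (t - s) * ∫ y, U s y i * (g ⋆ kernel ε) y := by
  have hUi : Integrable (uncurry U) ((volume : Measure ℝ).prod volume) :=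
    integrable_uncurry_of_bounded hUm hUb hU0
  have hk : Continuous (kernel (d := d) ε) := FunctionSpaces.Torus.continuous_kernel hε hε'
  have hke : ∀ z : UnitAddTorus d, kernel ε (-z) = kernel ε z := FunctionSpaces.Torus.kernel_neg hε hε'
  have hUim : StronglyMeasurable (uncurry fun s y => U s y i) := stronglyMeasurable_uncurry_apply hUm i
  have hUib : ∀ s y, ‖U s y i‖ ≤ M := fun s y => (PiLp.norm_apply_le (U s y) i).trans (hUb s y)
  obtain ⟨hΘm, hΘb⟩ := stronglyMeasurable_convolution_slice hUim hUib hε hε'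
  have h1 : ∀ x, FunctionSpaces.Torus.timeDeriv (mollifiedField φ ε U) t x i =
      ∫ s, deriv (φ.normed volume) (t - s) * ((fun y => U s y i) ⋆ kernel ε) x := fun x => by
    rw [timeDeriv_mollifiedField_apply hUm hUi hε hε', FunctionSpaces.timeAvgWith_eq_integral_sub]
    simp only [smul_eq_mul]
  simp_rw [h1]
  rw [integral_integral_kernel_mul_comm hΘm hΘb (integrable_deriv_normed φ) hg t]
  refine integral_congr_ae (Eventually.of_forall fun s => ?_)
  show deriv (φ.normed volume) (t - s) * ∫ x, ((fun y => U s y i) ⋆ kernel ε) x * g x =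
    deriv (φ.normed volume) (t - s) * ∫ y, U s y i * (g ⋆ kernel ε) y
  rw [FunctionSpaces.Torus.integral_mul_convolution_comm ((integrable_slice hUm hUb s).eval_piLp i)
    hg.integrable_unitAddTorus hk hke]

omit [DecidableEq d] in
/-- `∫ ‖k_ε‖ = 1`. [folklore] -/
theorem integral_norm_kernel (hε : 0 < ε) (hε' : ε ≤ 1 / 4) : ∫ y, ‖kernel (d := d) ε y‖ = 1 :=
  (integral_congr_ae (Eventually.of_forall fun y => by
    simp [Real.norm_eq_abs, abs_of_nonneg (FunctionSpaces.Torus.kernel_nonneg hε.le y)])).trans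
    (FunctionSpaces.Torus.integral_kernel (d := d) hε hε')

omit [DecidableEq d] in
/-- Coordinates of the real inner product on `ℝ^d`: `⟪a, b⟫ = ∑ᵢ aᵢ bᵢ` (private copy of the
identical `Torus.inner_eq_sum_mul` of `CoarseGrainingEstimates`, not imported here). [folklore] -/
private theorem inner_eq_sum_mul_coord (a b : EuclideanSpace ℝ d) : ⟪a, b⟫_ℝ = ∑ i, a i * b i := by
  rw [PiLp.inner_apply]
  refine Finset.sum_congr rfl fun i _ => ?_
  simp only [RCLike.inner_apply, conj_trivial, mul_comm]

omit [DecidableEq d] in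
/-- **Step 2.** `∫ ⟪∂ₜV(t), w⟫ = ∫ ρ'(t - s) (∫ ⟪U(s), w ⋆ k_ε⟫) ds` for the space–time
mollification `V = mollifiedField φ ε U` of a bounded measurable `U` and a smooth `w`. [folklore] -/
theorem integral_inner_timeDeriv_mollifiedField (hUm : StronglyMeasurable (uncurry U))
    (hUb : ∀ s y, ‖U s y‖ ≤ M) (hU0 : ∀ s, s ∉ Icc 0 T₀ → U s = 0) (hε : 0 < ε) (hε' : ε ≤ 1 / 4)
    {w : UnitAddTorus d → EuclideanSpace ℝ d} (hw : IsSmooth w) (t : ℝ) :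
    ∫ x, ⟪FunctionSpaces.Torus.timeDeriv (mollifiedField φ ε U) t x, w x⟫_ℝ =
      ∫ s, deriv (φ.normed volume) (t - s) * ∫ y, ⟪U s y, vecMollify ε w y⟫_ℝ := by
  have hUi : Integrable (uncurry U) ((volume : Measure ℝ).prod volume) :=
    integrable_uncurry_of_bounded hUm hUb hU0
  have hk : Continuous (kernel (d := d) ε) := FunctionSpaces.Torus.continuous_kernel hε hε'
  obtain ⟨Cw, hCw⟩ := FunctionSpaces.Torus.exists_forall_norm_le_of_continuous hw.continuous
  have hwi : ∀ i, Continuous fun x => w x i := fun i => continuous_euclidean_apply hw.continuous i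
  -- the mollified test field `Wᵢ = wᵢ ⋆ k_ε` and its bounds
  set W : d → UnitAddTorus d → ℝ := fun i => (fun x => w x i) ⋆ kernel (d := d) ε with hW
  have hWi : ∀ i, Continuous (W i) := fun i =>
    FunctionSpaces.Torus.continuous_convolution (hwi i).integrable_unitAddTorus hk
  have hCW : ∀ i x, ‖W i x‖ ≤ Cw := fun i x => by
    have h := norm_convolution_le_of_bound (fun y => (PiLp.norm_apply_le (w y) i).trans (hCw y)) hk x
    rwa [integral_norm_kernel hε hε', mul_one] at h
  -- the coordinates of the time integral
  set c : d → ℝ → ℝ := fun i s => ∫ y, U s y i * W i y with hc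
  have hci : ∀ i, StronglyMeasurable (c i) ∧ ∀ s, ‖c i s‖ ≤ M * Cw := fun i =>
    stronglyMeasurable_integral_mul (stronglyMeasurable_uncurry_apply hUm i)
      (fun s y => (PiLp.norm_apply_le (U s y) i).trans (hUb s y)) (hWi i) (hCW i)
  have hρ't : Integrable (fun s => deriv (φ.normed volume) (t - s)) volume :=
    (integrable_deriv_normed φ).comp_sub_left t
  have hIi : ∀ i, Integrable (fun s => deriv (φ.normed volume) (t - s) * c i s) volume := fun i =>
    hρ't.mul_bdd (hci i).1.aestronglyMeasurable (Eventually.of_forall (hci i).2)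
  -- continuity of `∂ₜV(t)`
  have hdVtc : Continuous (FunctionSpaces.Torus.timeDeriv (mollifiedField φ ε U) t) :=
    (continuous_uncurry_timeDeriv_mollifiedField hUi hε hε' hU0).uncurry_left t
  -- left-hand side, coordinatewise
  have hL : ∫ x, ⟪FunctionSpaces.Torus.timeDeriv (mollifiedField φ ε U) t x, w x⟫_ℝ =
      ∑ i, ∫ s, deriv (φ.normed volume) (t - s) * c i s := by
    simp_rw [inner_eq_sum_mul_coord]
    rw [integral_finsetSum _ fun i _ =>
      (show Integrable (fun x => FunctionSpaces.Torus.timeDeriv (mollifiedField φ ε U) t x i * w x i) volume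
        from ((continuous_euclidean_apply hdVtc i).mul (hwi i)).integrable_unitAddTorus)]
    refine Finset.sum_congr rfl fun i _ => ?_
    exact integral_timeDeriv_mollifiedField_apply_mul hUm hUb hU0 hε hε' i (hwi i) t
  -- right-hand side, coordinatewise
  have hR : ∫ s, deriv (φ.normed volume) (t - s) * ∫ y, ⟪U s y, vecMollify ε w y⟫_ℝ =
      ∑ i, ∫ s, deriv (φ.normed volume) (t - s) * c i s := by
    rw [← integral_finsetSum _ fun i _ => hIi i]
    refine integral_congr_ae (Eventually.of_forall fun s => ?_)
    simp only
    rw [← Finset.mul_sum]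
    congr 1
    rw [← integral_finsetSum _ fun i _ => ((integrable_slice hUm hUb s).eval_piLp i).mul_bdd
      (hWi i).aestronglyMeasurable (Eventually.of_forall (hCW i))]
    refine integral_congr_ae (Eventually.of_forall fun y => ?_)
    simp only
    rw [inner_eq_sum_mul_coord]
    refine Finset.sum_congr rfl fun i _ => ?_
    rw [FunctionSpaces.Torus.vecMollify_apply]
  rw [hL, hR]

end TimeDeriv

/-! ## Step 3: the mollified flux against a smooth field -/

section Flux

variable {U : ℝ → UnitAddTorus d → EuclideanSpace ℝ d} {φ : ContDiffBump (0 : ℝ)} {ε M T₀ : ℝ}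

omit [DecidableEq d] in
/-- The columns `UⱼU` of `U ⊗ U` are admissible data (measurable, bounded, supported in the slab),
so their space–time mollifications are integrable data for the `mollifiedField` calculus. [folklore] -/
theorem integrable_uncurry_smul_apply (hUm : StronglyMeasurable (uncurry U)) (hUb : ∀ s y, ‖U s y‖ ≤ M)
    (hU0 : ∀ s, s ∉ Icc 0 T₀ → U s = 0) (j : d) :
    Integrable (uncurry fun s y => U s y j • U s y) ((volume : Measure ℝ).prod volume) :=
  integrable_uncurry_of_bounded (stronglyMeasurable_uncurry_smul_apply hUm j) (norm_smul_apply_le hUb j)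
    (fun s hs => smul_apply_eq_zero_off hU0 j s hs)

omit [DecidableEq d] in
/-- Slices of the mollified flux are smooth tensor fields. [folklore] -/
theorem isSmooth_mollifiedFlux (hUm : StronglyMeasurable (uncurry U)) (hUb : ∀ s y, ‖U s y‖ ≤ M)
    (hU0 : ∀ s, s ∉ Icc 0 T₀ → U s = 0) (hε : 0 < ε) (hε' : ε ≤ 1 / 4) (t : ℝ) :
    IsSmooth (mollifiedFlux φ ε U t) :=
  isSmooth_tensor fun j => isSmooth_mollifiedField (integrable_uncurry_smul_apply hUm hUb hU0 j) hε hε' t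

omit [DecidableEq d] in
/-- **Step 3, one entry.** `∫ 𝒯ⱼᵢ(t) g = ∫ ρ(t - s) (∫ UⱼUᵢ(s) (g ⋆ k_ε)) ds` for a continuous
scalar `g`. [folklore] -/
theorem integral_mollifiedFlux_apply_mul (hUm : StronglyMeasurable (uncurry U))
    (hUb : ∀ s y, ‖U s y‖ ≤ M) (hU0 : ∀ s, s ∉ Icc 0 T₀ → U s = 0) (hε : 0 < ε) (hε' : ε ≤ 1 / 4)
    (j i : d) {g : UnitAddTorus d → ℝ} (hg : Continuous g) (t : ℝ) :
    ∫ x, mollifiedFlux φ ε U t x j i * g x =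
      ∫ s, φ.normed volume (t - s) * ∫ y, (U s y j * U s y i) * (g ⋆ kernel ε) y := by
  have hM : 0 ≤ M := (norm_nonneg _).trans (hUb 0 0)
  have hUi := integrable_uncurry_smul_apply hUm hUb hU0 j
  have hk : Continuous (kernel (d := d) ε) := FunctionSpaces.Torus.continuous_kernel hε hε'
  have hke : ∀ z : UnitAddTorus d, kernel ε (-z) = kernel ε z := FunctionSpaces.Torus.kernel_neg hε hε'
  have hΘm₀ : StronglyMeasurable (uncurry fun s y => (U s y j • U s y) i) :=
    stronglyMeasurable_uncurry_apply (stronglyMeasurable_uncurry_smul_apply hUm j) i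
  have hΘb₀ : ∀ s y, ‖(U s y j • U s y) i‖ ≤ M ^ 2 := fun s y =>
    (PiLp.norm_apply_le (U s y j • U s y) i).trans (norm_smul_apply_le hUb j s y)
  obtain ⟨hΘm, hΘb⟩ := stronglyMeasurable_convolution_slice hΘm₀ hΘb₀ hε hε'
  have h1 : ∀ x, mollifiedFlux φ ε U t x j i =
      ∫ s, φ.normed volume (t - s) * ((fun y => (U s y j • U s y) i) ⋆ kernel ε) x := fun x => by
    rw [mollifiedFlux_apply, mollifiedField_apply_eq_timeAvgWith hUi hε hε',
      FunctionSpaces.timeAvgWith_eq_integral_sub]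
    simp only [smul_eq_mul]
  simp_rw [h1]
  rw [integral_integral_kernel_mul_comm hΘm hΘb φ.integrable_normed hg t]
  refine integral_congr_ae (Eventually.of_forall fun s => ?_)
  show φ.normed volume (t - s) * ∫ x, ((fun y => (U s y j • U s y) i) ⋆ kernel ε) x * g x =
    φ.normed volume (t - s) * ∫ y, (U s y j * U s y i) * (g ⋆ kernel ε) y
  have hsl : Integrable (fun y => (U s y j • U s y) i) volume :=
    (integrable_const (M ^ 2)).mono' (hΘm₀.comp_measurable
      (measurable_const.prodMk measurable_id)).aestronglyMeasurable (Eventually.of_forall (hΘb₀ s))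
  rw [← FunctionSpaces.Torus.integral_mul_convolution_comm hsl hg.integrable_unitAddTorus hk hke]
  congr 1

/-- **Step 3.** `∫ ⟪div 𝒯(t), w⟫ = -∫ ρ(t - s) (∫ ⟪U(s), (U(s)·∇)(w ⋆ k_ε)⟫) ds` for the mollified
flux of a bounded measurable `U` and a smooth `w` (no boundary on the torus, Fubini, symmetry of
the even kernel, and `∂ⱼ(wᵢ ⋆ k_ε) = (∂ⱼwᵢ) ⋆ k_ε`). [folklore] -/
theorem integral_inner_tensorDivergence_mollifiedFlux (hUm : StronglyMeasurable (uncurry U))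
    (hUb : ∀ s y, ‖U s y‖ ≤ M) (hU0 : ∀ s, s ∉ Icc 0 T₀ → U s = 0) (hε : 0 < ε) (hε' : ε ≤ 1 / 4)
    {w : UnitAddTorus d → EuclideanSpace ℝ d} (hw : IsSmooth w) (t : ℝ) :
    ∫ x, ⟪tensorDivergence (mollifiedFlux φ ε U t) x, w x⟫_ℝ =
      -∫ s, φ.normed volume (t - s) *
        ∫ y, ⟪U s y, FunctionSpaces.Torus.convect (U s) (vecMollify ε w) y⟫_ℝ := by
  have hM : 0 ≤ M := (norm_nonneg _).trans (hUb 0 0)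
  have hk : Continuous (kernel (d := d) ε) := FunctionSpaces.Torus.continuous_kernel hε hε'
  have hks : IsSmooth (kernel (d := d) ε) := FunctionSpaces.Torus.isSmooth_kernel hε hε'
  have hT : IsSmooth (mollifiedFlux φ ε U t) := isSmooth_mollifiedFlux hUm hUb hU0 hε hε' t
  -- the scalar derivatives `gⱼᵢ = ∂ⱼwᵢ`, continuous and bounded
  set g : d → d → UnitAddTorus d → ℝ := fun j i => FunctionSpaces.Torus.partialDeriv j (fun y => w y i) with hg
  have hwi : ∀ i, IsSmooth fun y => w y i := fun i => hw.apply i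
  have hgc : ∀ j i, Continuous (g j i) := fun j i => ((hwi i).partialDeriv j).continuous
  have hgs : ∀ j i, IsSmooth (g j i) := fun j i => (hwi i).partialDeriv j
  -- the mollified test field and the derivatives of its coordinates
  have hW : IsSmooth (vecMollify ε w) := FunctionSpaces.Torus.isSmooth_vecMollify hw.integrable hε hε'
  have hdW : ∀ j i x, FunctionSpaces.Torus.partialDeriv j (fun y => vecMollify ε w y i) x = (g j i ⋆ kernel ε) x := by
    intro j i x
    have hfun : (fun y => vecMollify ε w y i) = (fun y => w y i) ⋆ kernel ε := by
      funext y
      rw [FunctionSpaces.Torus.vecMollify_apply]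
    rw [hfun, FunctionSpaces.Torus.partialDeriv_convolution (hwi i).integrable hks,
      FunctionSpaces.Torus.convolution_partialDeriv_right (hwi i) hks]
  -- bounds on `g ⋆ k_ε`
  obtain ⟨Cg, hCg⟩ : ∃ Cg, ∀ j i x, ‖(g j i ⋆ kernel (d := d) ε) x‖ ≤ Cg := by
    have h : ∀ j i, ∃ C, ∀ x, ‖(g j i ⋆ kernel (d := d) ε) x‖ ≤ C := fun j i =>
      FunctionSpaces.Torus.exists_forall_norm_le_of_continuous
        (FunctionSpaces.Torus.continuous_convolution (hgc j i).integrable_unitAddTorus hk)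
    choose C hC using h
    refine ⟨∑ j, ∑ i, |C j i|, fun j i x => (hC j i x).trans ((le_abs_self _).trans ?_)⟩
    exact (Finset.single_le_sum (fun i _ => abs_nonneg (C j i)) (Finset.mem_univ i)).trans
      (Finset.single_le_sum (fun j _ => Finset.sum_nonneg fun i _ => abs_nonneg (C j i))
        (Finset.mem_univ j))
  have hgkc : ∀ j i, Continuous (g j i ⋆ kernel (d := d) ε) := fun j i =>
    FunctionSpaces.Torus.continuous_convolution (hgc j i).integrable_unitAddTorus hk
  -- the coordinates of the time integral
  set c : d → d → ℝ → ℝ := fun j i s => ∫ y, (U s y j * U s y i) * (g j i ⋆ kernel ε) y with hc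
  have hUji_m : ∀ j i, StronglyMeasurable (uncurry fun s y => U s y j * U s y i) := fun j i =>
    (stronglyMeasurable_uncurry_apply hUm j).mul (stronglyMeasurable_uncurry_apply hUm i)
  have hUji_b : ∀ j i s y, ‖U s y j * U s y i‖ ≤ M * M := fun j i s y => by
    rw [norm_mul]
    exact mul_le_mul ((PiLp.norm_apply_le (U s y) j).trans (hUb s y))
      ((PiLp.norm_apply_le (U s y) i).trans (hUb s y)) (norm_nonneg _) hM
  have hci : ∀ j i, StronglyMeasurable (c j i) ∧ ∀ s, ‖c j i s‖ ≤ M * M * Cg := fun j i =>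
    stronglyMeasurable_integral_mul (hUji_m j i) (hUji_b j i) (hgkc j i) (hCg j i)
  have hρt : Integrable (fun s => φ.normed volume (t - s)) volume := φ.integrable_normed.comp_sub_left t
  have hIi : ∀ j i, Integrable (fun s => φ.normed volume (t - s) * c j i s) volume := fun j i =>
    hρt.mul_bdd (hci j i).1.aestronglyMeasurable (Eventually.of_forall (hci j i).2)
  -- the slice integrands `y ↦ UⱼUᵢ (gⱼᵢ ⋆ k_ε)` are integrable
  have hUs : ∀ s i, AEStronglyMeasurable (fun y => U s y i) volume := fun s i =>
    ((stronglyMeasurable_uncurry_apply hUm i).comp_measurable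
      (measurable_const.prodMk measurable_id)).aestronglyMeasurable
  have hsl : ∀ j i s, Integrable (fun y => (U s y j * U s y i) * (g j i ⋆ kernel ε) y) volume := by
    intro j i s
    have h1 : Integrable (fun y => U s y j * U s y i) volume :=
      ((integrable_slice hUm hUb s).eval_piLp j).mul_bdd (hUs s i)
        (Eventually.of_forall fun y => (PiLp.norm_apply_le (U s y) i).trans (hUb s y))
    exact h1.mul_bdd (hgkc j i).aestronglyMeasurable (Eventually.of_forall (hCg j i))
  -- continuity of the entries of `𝒯(t)`
  have hTc : ∀ j i, Continuous fun x => mollifiedFlux φ ε U t x j i := fun j i =>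
    continuous_euclidean_apply ((continuous_apply j).comp hT.continuous) i
  -- left-hand side
  have hL : ∫ x, ⟪tensorDivergence (mollifiedFlux φ ε U t) x, w x⟫_ℝ =
      -∑ j, ∑ i, ∫ s, φ.normed volume (t - s) * c j i s := by
    rw [integral_inner_tensorDivergence hT hw]
    congr 1
    have hentry : ∀ x, ∑ j, ⟪mollifiedFlux φ ε U t x j, FunctionSpaces.Torus.partialDeriv j w x⟫_ℝ =
        ∑ j, ∑ i, mollifiedFlux φ ε U t x j i * g j i x := fun x => by
      refine Finset.sum_congr rfl fun j _ => ?_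
      rw [inner_eq_sum_mul_coord]
      refine Finset.sum_congr rfl fun i _ => ?_
      rw [← FunctionSpaces.Torus.partialDeriv_apply_coord (hw.isContDiff (by simp)) j x i]
    simp_rw [hentry]
    rw [integral_finsetSum _ fun j _ => integrable_finsetSum _ fun i _ =>
      (show Integrable (fun x => mollifiedFlux φ ε U t x j i * g j i x) volume from
        ((hTc j i).mul (hgc j i)).integrable_unitAddTorus)]
    refine Finset.sum_congr rfl fun j _ => ?_
    rw [integral_finsetSum _ fun i _ =>
      (show Integrable (fun x => mollifiedFlux φ ε U t x j i * g j i x) volume from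
        ((hTc j i).mul (hgc j i)).integrable_unitAddTorus)]
    refine Finset.sum_congr rfl fun i _ => ?_
    exact integral_mollifiedFlux_apply_mul hUm hUb hU0 hε hε' j i (hgc j i) t
  -- right-hand side
  have hslice : ∀ s, ∫ y, ⟪U s y, FunctionSpaces.Torus.convect (U s) (vecMollify ε w) y⟫_ℝ =
      ∑ i, ∑ j, c j i s := by
    intro s
    rw [← Finset.sum_congr rfl fun i _ => integral_finsetSum _ fun j _ => hsl j i s,
      ← integral_finsetSum _ fun i _ => integrable_finsetSum _ fun j _ => hsl j i s]
    refine integral_congr_ae (Eventually.of_forall fun y => ?_)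
    simp only
    rw [FunctionSpaces.Torus.convect, inner_fderiv_apply_eq_sum hW y (U s y)]
    refine Finset.sum_congr rfl fun i _ => Finset.sum_congr rfl fun j _ => ?_
    rw [hdW j i y]
    ring
  have hR : ∫ s, φ.normed volume (t - s) *
      ∫ y, ⟪U s y, FunctionSpaces.Torus.convect (U s) (vecMollify ε w) y⟫_ℝ =
      ∑ i, ∑ j, ∫ s, φ.normed volume (t - s) * c j i s := by
    simp_rw [hslice, Finset.mul_sum]
    rw [integral_finsetSum _ fun i _ => integrable_finsetSum _ fun j _ => hIi j i]
    refine Finset.sum_congr rfl fun i _ => ?_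
    exact integral_finsetSum _ fun j _ => hIi j i
  rw [hL, hR, Finset.sum_comm]

end Flux

/-! ## The mollified Euler equation up to a gradient -/

section Main

variable {U : ℝ → UnitAddTorus d → EuclideanSpace ℝ d} {φ : ContDiffBump (0 : ℝ)} {ε M T₀ : ℝ}

/-- The residual `∂ₜV(t) + div 𝒯(t)` is a smooth (in particular continuous) field on the torus. [folklore] -/
theorem isSmooth_mollifiedEulerResidual (hUm : StronglyMeasurable (uncurry U)) (hUb : ∀ s y, ‖U s y‖ ≤ M)
    (hU0 : ∀ s, s ∉ Icc 0 T₀ → U s = 0) (hε : 0 < ε) (hε' : ε ≤ 1 / 4) (t : ℝ) :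
    IsSmooth (mollifiedEulerResidual φ ε U t) := by
  have hUi : Integrable (uncurry U) ((volume : Measure ℝ).prod volume) :=
    integrable_uncurry_of_bounded hUm hUb hU0
  have h1 : IsSmooth (FunctionSpaces.Torus.timeDeriv (mollifiedField φ ε U) t) :=
    ((isSpaceTimeTest_mollifiedField (φ := φ) hUi hε hε' hU0).timeDeriv).isSmooth_slice t
  have h2 : IsSmooth (tensorDivergence (mollifiedFlux φ ε U t)) :=
    (isSmooth_mollifiedFlux (φ := φ) hUm hUb hU0 hε hε' t).tensorDivergence
  exact h1.add h2

/-- **The space–time mollification of a weak Euler solution solves Euler–Reynolds up to a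
gradient** (Buckmaster–Vicol 2019, §2.5: "Since `u` is a solution of the Euler equations, there
exists a mean-free `p_n` such that `∂ₜv_n + div((u ⊗ u) ∗ φ ∗ ϕ) + ∇p_n = 0`"; Constantin–E–Titi
1994, p. 209). Let `U` be bounded and strongly measurable on `ℝ × T^d`, vanishing off the slab
`[0, T₀]`, and a weak Euler solution on `T^d × (0, T₀)` (`Torus.IsWeakEulerSolutionOn`, pressure-free
distributional form). Then for `0 < ε ≤ 1/4` and every `t` with `[t - rOut, t + rOut] ⊆ (0, T₀)`, the
residual `∂ₜV(t) + div 𝒯(t)` of the mollified field `V = mollifiedField φ ε U` and flux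
`𝒯 = mollifiedFlux φ ε U` is `L²`-orthogonal to every smooth divergence-free field:
`∫ ⟪∂ₜV(t) + div 𝒯(t), w⟫ = 0`. [cite: BuckmasterVicol2019Annals, §2.5] -/
theorem integral_inner_mollifiedEulerResidual_eq_zero (hUm : StronglyMeasurable (uncurry U))
    (hUb : ∀ s y, ‖U s y‖ ≤ M) (hU0 : ∀ s, s ∉ Icc 0 T₀ → U s = 0)
    (hweak : FunctionSpaces.Torus.IsWeakEulerSolutionOn T₀ U) (hε : 0 < ε) (hε' : ε ≤ 1 / 4)
    {t : ℝ} (ht1 : φ.rOut < t) (ht2 : t + φ.rOut < T₀)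
    {w : UnitAddTorus d → EuclideanSpace ℝ d} (hw : IsSmooth w) (hdiv : IsDivFree w) :
    ∫ x, ⟪mollifiedEulerResidual φ ε U t x, w x⟫_ℝ = 0 := by
  have hUi : Integrable (uncurry U) ((volume : Measure ℝ).prod volume) :=
    integrable_uncurry_of_bounded hUm hUb hU0
  have hks : IsSmooth (kernel (d := d) ε) := FunctionSpaces.Torus.isSmooth_kernel hε hε'
  -- the mollified test field
  have hW : IsSmooth (vecMollify ε w) := FunctionSpaces.Torus.isSmooth_vecMollify hw.integrable hε hε'
  have hWdiv : IsDivFree (vecMollify ε w) := by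
    have h := FunctionSpaces.Torus.IsDivFree.vecConv hw hdiv hks
    exact h
  -- the three steps
  have h1 := weakEuler_product_test (φ := φ) hUm hUb hweak ht1 ht2 hW hWdiv
  have h2 := integral_inner_timeDeriv_mollifiedField (φ := φ) hUm hUb hU0 hε hε' hw t
  have h3 := integral_inner_tensorDivergence_mollifiedFlux (φ := φ) hUm hUb hU0 hε hε' hw t
  -- split the residual
  have hc1 : Continuous (FunctionSpaces.Torus.timeDeriv (mollifiedField φ ε U) t) :=
    (continuous_uncurry_timeDeriv_mollifiedField hUi hε hε' hU0).uncurry_left t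
  have hc2 : Continuous (tensorDivergence (mollifiedFlux φ ε U t)) :=
    (isSmooth_mollifiedFlux (φ := φ) hUm hUb hU0 hε hε' t).tensorDivergence.continuous
  have hsplit : ∫ x, ⟪mollifiedEulerResidual φ ε U t x, w x⟫_ℝ =
      (∫ x, ⟪FunctionSpaces.Torus.timeDeriv (mollifiedField φ ε U) t x, w x⟫_ℝ) +
        ∫ x, ⟪tensorDivergence (mollifiedFlux φ ε U t) x, w x⟫_ℝ := by
    rw [← integral_add (hc1.inner hw.continuous).integrable_unitAddTorus
      (hc2.inner hw.continuous).integrable_unitAddTorus]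
    refine integral_congr_ae (Eventually.of_forall fun x => ?_)
    show ⟪mollifiedEulerResidual φ ε U t x, w x⟫_ℝ = _
    rw [mollifiedEulerResidual_apply, inner_add_left]
  rw [hsplit, h2, h3, h1]
  ring

end Main

end Torus

end Literature.Analysis.FluidPDE

end
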